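import Summits.CriticalPhenomena.PercolationContinuityZ3.Theorems.PercNearOneGluingNoHeavyLowerTailOneCutFiveZeroOneHalf
import Literature.Probability.Percolation.KozmaNitzanSeparatingTriple
import HarnessLib

/-!
# `Z(3,2)` / LNT♯-EN layer 2: the pocket exchange holds up to the LONELY masses of the two stronger vertices
# (Kozma–Nitzan's Lemma 4 in pocket form), hence `Z(3,2)` whenever those masses fit inside the reliability gap

builds on p205010 (kernel theorem, internal audit signed; external expert review pending)

Support file (prover seat `prim-quant-p1` gen 2, QUANT lane rung R8 = LNT♯-EN layer 2; `--supports stmt-CriticalPhenomena-4575`).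
No definitions, no named facts, no sorries; standard axioms.  Memo: `run/shared/lean/prim/quant/P1-SURPLUS.md` §12.

`μ = prodBernoulli w` on `Fin n`, observer `o`, vertices `a, b, c`, `q_v = μ(o ↔ v)`, pocket `B = C_o ∩ {a,b,c}`, atoms
`s_a = μ(B = {a})`, `d_bc = μ(B = {b,c})`; the LONELY masses `u_b := μ(B = {b}, a ↮ c)`, `u_c := μ(B = {c}, a ↮ b)` (o reaches exactly
one of the two stronger vertices while the other two targets lie in different clusters).  GLUING IDENTITY (elementary, this memo §12):
with `G* = G/{b = c}`, `μ_{G*}(o ↔ {b,c}) − μ_{G*}(o ↔ a) = (d_bc − s_a) + u_b + u_c`; and Kozma–Nitzan's Lemma 4 in the gluing form (9)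
(tree: `KozmaNitzan2024_lemma4_glued`, `KNSep.lemma4_core`) bounds the left side below by `min(q_b, q_c) − q_a`.  Hence, on EVERY finite
weighted graph and with NO regime hypothesis:

* `OneCutFive.pocketExchange_gap` — **`min(q_b, q_c) − q_a ≤ (d_bc − s_a) + u_b + u_c`.**
* `OneCutFive.pocketExchange_of_lonely_le_gap` — hence the pocket exchange `s_a ≤ d_bc` (the open core of `Z(3,2)` = `OneCutFive.ZeroOneThree`,
  cf. `…OneCutFiveZeroOnePocket`) holds as soon as `u_b + u_c ≤ min(q_b, q_c) − q_a`;
* `OneCutFive.le_one_reached_le_of_lonely_le_gap` — and then `μ{o reaches ≤ 1 of a,b,c} ≤ t` for every `t ≥ μ(o ↮ a)` (the `Z(3,2)`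
  conclusion), via the tree's exchange step `measureReal_le_one_le_compl_of_exchange`.

The regime `u_b + u_c ≤ gap` is a full-dimensional neighbourhood of the tight family `T12` of `Z(3,2)` (`b, c` glued, where `u_b = u_c = 0`
and the bound is the identity `d_bc − s_a = q_{bc} − q_a`); it is disjoint from the three-way-tie core (gap `0`), where the exact
second-order-tight wedge family W4 of the memo lives.  Complementary to `pocketExchange_of_pair_sum` (`q_b + q_c ≥ 1 + q_a`),
`pocketExchange_glued_of_le` (the `b ↔ c` piece) and `pocketExchange_of_indep_weakest/_other`.
HONEST LABEL: a partial result toward `Z(3,2)` (OPEN); nothing here asserts `Z(3,2)`.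
[cite: KozmaNitzan2024, Lemma 4 and eq. (8)–(9) (pp. 9–10)]
-/

noncomputable section

namespace Summit.CriticalPhenomena.PercolationContinuityZ3.Theorems

open MeasureTheory Set Literature.Probability.LatticeModels Literature.Probability.Percolation
open scoped Classical BigOperators

namespace OneCutFive

variable {n : ℕ}

/-- Oriented half of the gap bound: if `c` is the vertex of `{b, c}` that Kozma–Nitzan's Lemma 4 selects (the minimiser in
`KNSep.lemma4_core` with `a₃ = a`, `a₁ = b`, `a₂ = c`, target `o`), then `q_c − q_a ≤ (d_bc − s_a) + u_b + u_c`.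
[cite: KozmaNitzan2024, Lemma 4 (p. 9, proof)] -/
theorem pocketExchange_gap_aux (w : Sym2 (Fin n) → unitInterval) (o a b c : Fin n)
    (hmin : (prodBernoulli w).real ((openConn a b ∪ openConn a c) ∩ openConn c o) ≤
      (prodBernoulli w).real ((openConn a b ∪ openConn a c) ∩ openConn b o)) :
    (prodBernoulli w).real (openConn o c) - (prodBernoulli w).real (openConn o a) ≤
      ((prodBernoulli w).real {ω : BondConfig (Fin n) | ω ∉ openConn o a ∧ ω ∈ openConn o b ∧ ω ∈ openConn o c} -
          (prodBernoulli w).real {ω : BondConfig (Fin n) | ω ∈ openConn o a ∧ ω ∉ openConn o b ∧ ω ∉ openConn o c}) +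
        (prodBernoulli w).real {ω : BondConfig (Fin n) | ω ∉ openConn o a ∧ ω ∈ openConn o b ∧ ω ∉ openConn o c ∧ ω ∉ openConn a c} +
        (prodBernoulli w).real {ω : BondConfig (Fin n) | ω ∉ openConn o a ∧ ω ∉ openConn o b ∧ ω ∈ openConn o c ∧ ω ∉ openConn a b} := by
  set μ := prodBernoulli w with hμ
  have hmeas : ∀ s : Set (BondConfig (Fin n)), MeasurableSet s := fun _ => MeasurableSet.of_discrete
  have mem : ∀ (ω : BondConfig (Fin n)) (x y : Fin n),
      ω ∈ (openConn x y : Set (BondConfig (Fin n))) ↔ (openGraph ω).Reachable x y := fun _ _ _ => Iff.rfl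
  set A : Set (BondConfig (Fin n)) := openConn o a with hA
  set B : Set (BondConfig (Fin n)) := openConn o b with hB
  set C : Set (BondConfig (Fin n)) := openConn o c with hC
  set Sa : Set (BondConfig (Fin n)) := {ω | ω ∈ A ∧ ω ∉ B ∧ ω ∉ C} with hSa
  set Dbc : Set (BondConfig (Fin n)) := {ω | ω ∉ A ∧ ω ∈ B ∧ ω ∈ C} with hDbc
  set Dab : Set (BondConfig (Fin n)) := {ω | ω ∈ A ∧ ω ∈ B ∧ ω ∉ C} with hDab
  set Ub : Set (BondConfig (Fin n)) := {ω | ω ∉ A ∧ ω ∈ B ∧ ω ∉ C ∧ ω ∉ openConn a c} with hUb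
  set Uc : Set (BondConfig (Fin n)) := {ω | ω ∉ A ∧ ω ∉ B ∧ ω ∈ C ∧ ω ∉ openConn a b} with hUc
  -- the two "cross" atoms of Lemma 4: `P_b = {o↔b, a↔c, b↮c}`, `P_c = {o↔c, a↔b, b↮c}`
  set Pb : Set (BondConfig (Fin n)) := openConn b o ∩ openConn c a ∩ (openConn b c)ᶜ with hPb
  set Pc : Set (BondConfig (Fin n)) := openConn c o ∩ openConn b a ∩ (openConn b c)ᶜ with hPc
  set Pc' : Set (BondConfig (Fin n)) := {ω | ω ∉ A ∧ ω ∉ B ∧ ω ∈ C ∧ ω ∈ openConn a b} with hPc'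
  -- Kozma–Nitzan Lemma 4 (core chain): `μ(P_b) + μ(P_c) ≤ μ(o↔b, b↮c)`
  have L4 : μ.real Pb + μ.real Pc ≤ μ.real (openConn b o ∩ (openConn b c)ᶜ) :=
    KNSep.lemma4_core w b c a o hmin
  -- `{o↔b, b↮c} ⊆ Dab ∪ Ub ∪ P_b`
  have hcover : (openConn b o ∩ (openConn b c)ᶜ : Set (BondConfig (Fin n))) ⊆ Dab ∪ Ub ∪ Pb := by
    rintro ω ⟨hbo, hnbc⟩
    have hob : ω ∈ B := (SimpleGraph.Reachable.symm hbo : (openGraph ω).Reachable o b)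
    have hnoc : ω ∉ C := fun hoc => hnbc ((hbo.trans hoc : (openGraph ω).Reachable b c))
    by_cases hoa : ω ∈ A
    · exact Or.inl (Or.inl ⟨hoa, hob, hnoc⟩)
    · by_cases hac : ω ∈ (openConn a c : Set (BondConfig (Fin n)))
      · exact Or.inr ⟨⟨hbo, (SimpleGraph.Reachable.symm hac : (openGraph ω).Reachable c a)⟩, hnbc⟩
      · exact Or.inl (Or.inr ⟨hoa, hob, hnoc, hac⟩)
  have hcover' : μ.real (openConn b o ∩ (openConn b c)ᶜ) ≤ μ.real Dab + μ.real Ub + μ.real Pb := by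
    refine (measureReal_mono hcover).trans ?_
    exact (measureReal_union_le _ _).trans (by
      have := measureReal_union_le (μ := μ) Dab Ub
      linarith)
  -- `P_c' ⊆ P_c`
  have hPc'sub : Pc' ⊆ Pc := by
    rintro ω ⟨hnoa, hnob, hoc, hab⟩
    refine ⟨⟨(SimpleGraph.Reachable.symm hoc : (openGraph ω).Reachable c o),
      (SimpleGraph.Reachable.symm hab : (openGraph ω).Reachable b a)⟩, ?_⟩
    intro hbc
    exact hnob ((hoc.trans (SimpleGraph.Reachable.symm hbc) : (openGraph ω).Reachable o b))
  have hPc'le : μ.real Pc' ≤ μ.real Pc := measureReal_mono hPc'sub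
  -- cell bookkeeping: `q_c − q_a = μ(C \ A) − μ(A \ C)`
  have hqc : μ.real C = μ.real (C ∩ A) + μ.real (C \ A) :=
    (measureReal_inter_add_sdiff (μ := μ) (s := C) (hmeas A) (measure_ne_top _ _)).symm
  have hqa : μ.real A = μ.real (A ∩ C) + μ.real (A \ C) :=
    (measureReal_inter_add_sdiff (μ := μ) (s := A) (hmeas C) (measure_ne_top _ _)).symm
  have hCA : C ∩ A = A ∩ C := Set.inter_comm _ _
  -- `μ(C \ A) = d_bc + s_c'`, `s_c' := μ{¬A, ¬B, C} = u_c + μ(P_c')`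
  have hCdiff : μ.real (C \ A) = μ.real Dbc + (μ.real Uc + μ.real Pc') := by
    have h1 : μ.real (C \ A) = μ.real ((C \ A) ∩ B) + μ.real ((C \ A) \ B) :=
      (measureReal_inter_add_sdiff (μ := μ) (s := C \ A) (hmeas B) (measure_ne_top _ _)).symm
    have e1 : (C \ A) ∩ B = Dbc := by
      ext ω; simp only [hDbc, mem_inter_iff, mem_sdiff, mem_setOf_eq]; tauto
    have h2 : μ.real ((C \ A) \ B) = μ.real (((C \ A) \ B) ∩ (openConn a b : Set (BondConfig (Fin n)))) +
        μ.real (((C \ A) \ B) \ (openConn a b : Set (BondConfig (Fin n)))) :=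
      (measureReal_inter_add_sdiff (μ := μ) (s := (C \ A) \ B) (hmeas (openConn a b : Set (BondConfig (Fin n)))) (measure_ne_top _ _)).symm
    have e2 : ((C \ A) \ B) ∩ (openConn a b : Set (BondConfig (Fin n))) = Pc' := by
      ext ω; simp only [hPc', mem_inter_iff, mem_sdiff, mem_setOf_eq]; tauto
    have e3 : ((C \ A) \ B) \ (openConn a b : Set (BondConfig (Fin n))) = Uc := by
      ext ω; simp only [hUc, mem_sdiff, mem_setOf_eq]; tauto
    rw [h1, e1, h2, e2, e3]; ring
  -- `μ(A \ C) = s_a + d_ab`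
  have hAdiff : μ.real (A \ C) = μ.real Sa + μ.real Dab := by
    have h1 : μ.real (A \ C) = μ.real ((A \ C) ∩ B) + μ.real ((A \ C) \ B) :=
      (measureReal_inter_add_sdiff (μ := μ) (s := A \ C) (hmeas B) (measure_ne_top _ _)).symm
    have e1 : (A \ C) ∩ B = Dab := by
      ext ω; simp only [hDab, mem_inter_iff, mem_sdiff, mem_setOf_eq]; tauto
    have e2 : (A \ C) \ B = Sa := by
      ext ω; simp only [hSa, mem_sdiff, mem_setOf_eq]; tauto
    rw [h1, e1, e2]; ring
  -- assemble
  have key : μ.real C - μ.real A = μ.real Dbc + μ.real Uc + μ.real Pc' - μ.real Sa - μ.real Dab := by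
    rw [hqc, hqa, hCA, hCdiff, hAdiff]; ring
  have hPb0 : 0 ≤ μ.real Pb := measureReal_nonneg
  linarith [key, L4, hcover', hPc'le]

/-- **The pocket exchange up to the lonely masses (Kozma–Nitzan's Lemma 4 in pocket form).**  For every finite weighted graph
and vertices `o, a, b, c`:  `min(q_b, q_c) − q_a ≤ (d_bc − s_a) + u_b + u_c`, where `q_v = μ(o↔v)`, `s_a = μ(o↔a, o↮b, o↮c)`,
`d_bc = μ(o↮a, o↔b, o↔c)`, `u_b = μ(o↮a, o↔b, o↮c, a↮c)`, `u_c = μ(o↮a, o↮b, o↔c, a↮b)`.  Equality on the family `b, c` glued.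
[cite: KozmaNitzan2024, Lemma 4, eq. (8)–(9) (pp. 9–10)] -/
theorem pocketExchange_gap (w : Sym2 (Fin n) → unitInterval) (o a b c : Fin n) :
    min ((prodBernoulli w).real (openConn o b)) ((prodBernoulli w).real (openConn o c)) -
        (prodBernoulli w).real (openConn o a) ≤
      ((prodBernoulli w).real {ω : BondConfig (Fin n) | ω ∉ openConn o a ∧ ω ∈ openConn o b ∧ ω ∈ openConn o c} -
          (prodBernoulli w).real {ω : BondConfig (Fin n) | ω ∈ openConn o a ∧ ω ∉ openConn o b ∧ ω ∉ openConn o c}) +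
        (prodBernoulli w).real {ω : BondConfig (Fin n) | ω ∉ openConn o a ∧ ω ∈ openConn o b ∧ ω ∉ openConn o c ∧ ω ∉ openConn a c} +
        (prodBernoulli w).real {ω : BondConfig (Fin n) | ω ∉ openConn o a ∧ ω ∉ openConn o b ∧ ω ∈ openConn o c ∧ ω ∉ openConn a b} := by
  rcases le_total ((prodBernoulli w).real ((openConn a b ∪ openConn a c) ∩ openConn c o))
      ((prodBernoulli w).real ((openConn a b ∪ openConn a c) ∩ openConn b o)) with h | h
  · exact le_trans (by linarith [min_le_right ((prodBernoulli w).real (openConn o b)) ((prodBernoulli w).real (openConn o c))])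
      (pocketExchange_gap_aux w o a b c h)
  · -- the mirror case: swap `b` and `c`
    have h' : (prodBernoulli w).real ((openConn a c ∪ openConn a b) ∩ openConn b o) ≤
        (prodBernoulli w).real ((openConn a c ∪ openConn a b) ∩ openConn c o) := by
      rw [Set.union_comm]; exact h
    have aux := pocketExchange_gap_aux w o a c b h'
    have e1 : {ω : BondConfig (Fin n) | ω ∉ openConn o a ∧ ω ∈ openConn o c ∧ ω ∈ openConn o b} =
        {ω : BondConfig (Fin n) | ω ∉ openConn o a ∧ ω ∈ openConn o b ∧ ω ∈ openConn o c} := by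
      ext ω; simp only [mem_setOf_eq]; tauto
    have e2 : {ω : BondConfig (Fin n) | ω ∈ openConn o a ∧ ω ∉ openConn o c ∧ ω ∉ openConn o b} =
        {ω : BondConfig (Fin n) | ω ∈ openConn o a ∧ ω ∉ openConn o b ∧ ω ∉ openConn o c} := by
      ext ω; simp only [mem_setOf_eq]; tauto
    have e3 : {ω : BondConfig (Fin n) | ω ∉ openConn o a ∧ ω ∈ openConn o c ∧ ω ∉ openConn o b ∧ ω ∉ openConn a b} =
        {ω : BondConfig (Fin n) | ω ∉ openConn o a ∧ ω ∉ openConn o b ∧ ω ∈ openConn o c ∧ ω ∉ openConn a b} := by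
      ext ω; simp only [mem_setOf_eq]; tauto
    have e4 : {ω : BondConfig (Fin n) | ω ∉ openConn o a ∧ ω ∉ openConn o c ∧ ω ∈ openConn o b ∧ ω ∉ openConn a c} =
        {ω : BondConfig (Fin n) | ω ∉ openConn o a ∧ ω ∈ openConn o b ∧ ω ∉ openConn o c ∧ ω ∉ openConn a c} := by
      ext ω; simp only [mem_setOf_eq]; tauto
    rw [e1, e2, e3, e4] at aux
    linarith [min_le_left ((prodBernoulli w).real (openConn o b)) ((prodBernoulli w).real (openConn o c)), aux]

/-- **`Z(3,2)`'s pocket exchange when the lonely masses fit inside the reliability gap.**  If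
`u_b + u_c ≤ min(q_b, q_c) − q_a` then `s_a ≤ d_bc`.  (Covers a neighbourhood of the tight family `b, c` glued, `q_a < q_{bc}`;
empty at three-way ties.) [this work] -/
theorem pocketExchange_of_lonely_le_gap (w : Sym2 (Fin n) → unitInterval) (o a b c : Fin n)
    (h : (prodBernoulli w).real {ω : BondConfig (Fin n) | ω ∉ openConn o a ∧ ω ∈ openConn o b ∧ ω ∉ openConn o c ∧ ω ∉ openConn a c} +
        (prodBernoulli w).real {ω : BondConfig (Fin n) | ω ∉ openConn o a ∧ ω ∉ openConn o b ∧ ω ∈ openConn o c ∧ ω ∉ openConn a b} ≤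
      min ((prodBernoulli w).real (openConn o b)) ((prodBernoulli w).real (openConn o c)) - (prodBernoulli w).real (openConn o a)) :
    (prodBernoulli w).real {ω : BondConfig (Fin n) | ω ∈ openConn o a ∧ ω ∉ openConn o b ∧ ω ∉ openConn o c} ≤
      (prodBernoulli w).real {ω : BondConfig (Fin n) | ω ∉ openConn o a ∧ ω ∈ openConn o b ∧ ω ∈ openConn o c} := by
  have hg := pocketExchange_gap w o a b c
  linarith

/-- **The `Z(3,2)` conclusion in the lonely-mass regime.**  For distinct `a, b, c` with `u_b + u_c ≤ min(q_b, q_c) − q_a`,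
`μ{o reaches ≤ 1 of a,b,c} ≤ t` for every `t ≥ μ(o ↮ a)` (no `Σ q > 2` needed). [this work] -/
theorem le_one_reached_le_of_lonely_le_gap (w : Sym2 (Fin n) → unitInterval) (R : Finset (Fin n)) (o a b c : Fin n) (t : ℝ)
    (hR : R = {a, b, c}) (hab : a ≠ b) (hac : a ≠ c) (hbc : b ≠ c)
    (h : (prodBernoulli w).real {ω : BondConfig (Fin n) | ω ∉ openConn o a ∧ ω ∈ openConn o b ∧ ω ∉ openConn o c ∧ ω ∉ openConn a c} +
        (prodBernoulli w).real {ω : BondConfig (Fin n) | ω ∉ openConn o a ∧ ω ∉ openConn o b ∧ ω ∈ openConn o c ∧ ω ∉ openConn a b} ≤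
      min ((prodBernoulli w).real (openConn o b)) ((prodBernoulli w).real (openConn o c)) - (prodBernoulli w).real (openConn o a))
    (ht : (prodBernoulli w).real (openConn o a)ᶜ ≤ t) :
    (prodBernoulli w).real {ω : BondConfig (Fin n) | (R.filter fun v => ω ∈ openConn o v).card ≤ 1} ≤ t := by
  have hP := pocketExchange_of_lonely_le_gap w o a b c h
  have ha : a ∈ R := by simp [hR]
  have hb : b ∈ R := by simp [hR]
  have hc : c ∈ R := by simp [hR]
  exact (measureReal_le_one_le_compl_of_exchange w R o a b c ha hb hc hab hac hbc hP).trans ht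

end OneCutFive

end Summit.CriticalPhenomena.PercolationContinuityZ3.Theorems
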